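import Literature.Analysis.FluidPDE.Tao2016AveragedNS.SplitCascadeBlowupDynamics
import Mathlib.Analysis.ODE.Gronwall
import HarnessLib

/-!
# Tao's cascade ODE with the squared modes doubled, V: the asymmetry channels at the CASCADE level
# (one shell, one time window, Grönwall with the dissipation-class source)

T. Tao, *Finite time blowup for an averaged three-dimensional Navier–Stokes equation*, J. Amer.
Math. Soc. **29** (2016) 601–674 = arXiv:1402.0290v3, §5.3 (the amplifier), §5.5 (5.5) and the proof
of Theorem 5.3 (p. 29: the clock `b ≥ 0` during the epoch), §6.1 (6.1)–(6.8) [`Tao2016AveragedNS`];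
Grönwall's inequality in the form of Mathlib's `le_gronwallBound_of_liminf_deriv_right_le`
[`HairerNorsettWanner1993`, §I.10].

HONEST FRAMING (cell harvest/h2-tao-ladder, rung 1 of a ladder of MODEL equations; RUNG1-HANDOFF h4 /
R1-b, referee cycle 6 residual G-R1b): the circuit-level channel theorems of
`SplitDelayCircuitChannels.lean` (pseudo-orbits of the nine-mode circuit, defect `δ`) transported to
the objects the inductive step actually quantifies over — the shell amplitudes of a solution of the
split system `SplitODESystem` (6.0♯)–(6.8♯), on an arbitrary window `[t₁, t₂] ⊆ [0,∞)`, with the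
pseudo-orbit defect replaced by the dissipation-class allowance `C₁(1+ε₀)^{2n}E_n^{1/2}` of the rows
(6.Z1)–(6.Z3) (bounded by `σ` on the window). These are building blocks for the cell's open
inductive step (`splitBlowupDynamicsStep`); by themselves they certify nothing about the rung and
nothing about Navier–Stokes.

## What is proved (shell `n`, window `[t₁,t₂]`, `t₁ ≥ 0`, any `λ > 0`)

* `SplitODESystem.asym_c_sq_le_gronwallBound` — CHANNEL (A): if the clock `b_n ≥ -β` on the window,
  `Z_{c,n}(t)² ≤ gronwallBound (Z_{c,n}(t₁)²) (2Λₙε⁻¹K¹⁰β + λ) (σ²/λ) (t - t₁)`; with `β = 0` (Tao's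
  regime) the amplifier coupling `Λₙε⁻¹K¹⁰` does not amplify the asymmetry at all
  (`asym_c_sq_le_of_clock_nonneg`).
* `SplitODESystem.asym_ad_sq_le_gronwallBound` — CHANNELS (P)+(H), ROTOR NEUTRAL: if the pump rate
  `Λₙ(εb_n + ε²e^{-K¹⁰}S_{c,n}) ≤ M`, the hand-off rate `Λₙ(1+ε₀)^{5/2}K S_{a,n+1} ≤ M`, `|S_{a,n}|,
  |S_{d,n}| ≤ R` and `|Z_{c,n}| ≤ η_c` on the window, then
  `Z_{a,n}² + Z_{d,n}² ≤ gronwallBound (Z_{a,n}(t₁)² + Z_{d,n}(t₁)²) (2M + λ) (2G²/λ) (t - t₁)`,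
  `G = σ + Λₙε⁻²Rη_c` — the rotor terms `∓Λₙε⁻²S_cZ_aZ_d` cancel exactly; `ε⁻²` enters only through
  the slip forcing `Λₙε⁻²Z_c(S_d, -S_a)`.
* `SplitODESystem.asym_ad_sq_le_of_clock_nonneg` — the two combined in Tao's regime `b_n ≥ 0`:
  `η_c` derived from channel (A), rates `{λ, 2M}` only.
* `SplitODESystem.abs_Z_le_sqrt_two_mul_E`, `abs_S_le_sqrt_two_mul_E` — the trivial energy bounds
  `|Z_{i,n}|, |S_{i,n}| ≤ (2E_n)^{1/2}` ((6.7♯), used to feed `R`, `η_c` and the rates).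
-/

noncomputable section

open Set Metric Filter
open scoped Topology

namespace Literature.Analysis.FluidPDE.Tao2016AveragedNS

open TaoCascade

section Prelim

/-- `2ye ≤ λy² + e²/λ` for `λ > 0`. [folklore] -/
private theorem two_mul_mul_le_of_pos {lam : ℝ} (hlam : 0 < lam) (y e : ℝ) :
    2 * y * e ≤ lam * y ^ 2 + e ^ 2 / lam := by
  rw [← sub_nonneg]
  have h : lam * y ^ 2 + e ^ 2 / lam - 2 * y * e = (lam * y - e) ^ 2 / lam := by
    field_simp
    ring
  rw [h]
  positivity

/-- A `C¹` function on `[0,∞)` has, at every `τ ≥ 0`, its one-sided derivative as a right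
derivative within `[τ,∞)`. [folklore] -/
private theorem hasDerivWithinAt_Ici_of_contDiffOn {f : ℝ → ℝ} (hf : ContDiffOn ℝ 1 f (Ici 0))
    {τ : ℝ} (hτ : 0 ≤ τ) : HasDerivWithinAt f (derivWithin f (Ici 0) τ) (Ici τ) τ :=
  (((hf.differentiableOn one_ne_zero) τ hτ).hasDerivWithinAt).mono (Ici_subset_Ici.2 hτ)

end Prelim

section Channels

variable {ε₀ K ε C₁ C₂ : ℝ} {n₀ : ℤ} {S : Fin 4 → ℤ → ℝ → ℝ} {Z : Fin 3 → ℤ → ℝ → ℝ}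
  {E : ℤ → ℝ → ℝ}

/-- **The energy bounds the asymmetries**: `|Z_{i,n}(t)| ≤ (2E_n(t))^{1/2}` for `t ≥ 0` ((6.7♯)).
[cite: Tao2016AveragedNS, §6.1 (6.7)] -/
theorem SplitODESystem.abs_Z_le_sqrt_two_mul_E (hsol : SplitODESystem ε₀ K ε C₁ C₂ n₀ S Z E)
    (i : Fin 3) (n : ℤ) {t : ℝ} (ht : 0 ≤ t) : |Z i n t| ≤ Real.sqrt (2 * E n t) := by
  have h := hsol.defect_lower n t ht
  have hi : Z i n t ^ 2 ≤ ∑ j, Z j n t ^ 2 :=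
    Finset.single_le_sum (fun j _ => sq_nonneg (Z j n t)) (Finset.mem_univ i)
  have hS : 0 ≤ ∑ j, S j n t ^ 2 := Finset.sum_nonneg fun j _ => sq_nonneg _
  rw [← Real.sqrt_sq_eq_abs]
  exact Real.sqrt_le_sqrt (by linarith)

/-- **The energy bounds the symmetric amplitudes**: `|S_{i,n}(t)| ≤ (2E_n(t))^{1/2}` for `t ≥ 0`.
[cite: Tao2016AveragedNS, §6.1 (6.7)] -/
theorem SplitODESystem.abs_S_le_sqrt_two_mul_E (hsol : SplitODESystem ε₀ K ε C₁ C₂ n₀ S Z E)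
    (i : Fin 4) (n : ℤ) {t : ℝ} (ht : 0 ≤ t) : |S i n t| ≤ Real.sqrt (2 * E n t) := by
  have h := hsol.defect_lower n t ht
  have hi : S i n t ^ 2 ≤ ∑ j, S j n t ^ 2 :=
    Finset.single_le_sum (fun j _ => sq_nonneg (S j n t)) (Finset.mem_univ i)
  have hZ : 0 ≤ ∑ j, Z j n t ^ 2 := Finset.sum_nonneg fun j _ => sq_nonneg _
  rw [← Real.sqrt_sq_eq_abs]
  exact Real.sqrt_le_sqrt (by linarith)

/-- **Channel (A) at the cascade level (PROVED): the amplifier asymmetry of a shell is damped while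
its clock is non-negative, and only the dissipation-class source accumulates.** Let `(S,Z,E)` solve
the split system, fix a shell `n` and a window `[t₁,t₂]`, `t₁ ≥ 0`, on which the clock satisfies
`b_n = S 1 n ≥ -β` and the source of row (6.Z2) satisfies `C₁(1+ε₀)^{2n}E_n^{1/2} ≤ σ`. Then for
every `λ > 0` and `t ∈ [t₁,t₂]`,
`Z_{c,n}(t)² ≤ gronwallBound (Z_{c,n}(t₁)²) (2Λₙε⁻¹K¹⁰β + λ) (σ²/λ) (t - t₁)`, `Λₙ = (1+ε₀)^{5n/2}`.
[cite: Tao2016AveragedNS, Theorem 5.3 proof p. 29] -/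
theorem SplitODESystem.asym_c_sq_le_gronwallBound (hsol : SplitODESystem ε₀ K ε C₁ C₂ n₀ S Z E)
    (hε₀ : -1 < ε₀) (hε : 0 < ε) {n : ℤ} {t₁ t₂ β σ lam : ℝ} (ht₁ : 0 ≤ t₁) (hlam : 0 < lam)
    (hb : ∀ t ∈ Ico t₁ t₂, -β ≤ S 1 n t)
    (hσ : ∀ t ∈ Ico t₁ t₂, C₁ * (1 + ε₀) ^ ((2 : ℝ) * n) * Real.sqrt (E n t) ≤ σ)
    {t : ℝ} (ht : t ∈ Icc t₁ t₂) :
    Z 1 n t ^ 2 ≤ gronwallBound (Z 1 n t₁ ^ 2)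
      (2 * ((1 + ε₀) ^ ((5 : ℝ) * n / 2) * (ε⁻¹ * K ^ 10)) * β + lam) (σ ^ 2 / lam) (t - t₁) := by
  set Λ : ℝ := (1 + ε₀) ^ ((5 : ℝ) * n / 2) with hΛ
  have hΛ0 : 0 ≤ Λ := (Real.rpow_pos_of_pos (by linarith) _).le
  set y : ℝ → ℝ := Z 1 n with hy
  set y' : ℝ → ℝ := fun τ => derivWithin (Z 1 n) (Ici 0) τ with hy'
  have hder : ∀ τ ∈ Ico t₁ t₂, HasDerivWithinAt y (y' τ) (Ici τ) τ := fun τ hτ =>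
    hasDerivWithinAt_Ici_of_contDiffOn (hsol.contDiffOn_Z 1 n) (ht₁.trans hτ.1)
  have hyc : ContinuousOn y (Icc t₁ t₂) :=
    (hsol.contDiffOn_Z 1 n).continuousOn.mono fun s hs => (ht₁.trans hs.1 : (0 : ℝ) ≤ s)
  have hf' : ∀ τ ∈ Ico t₁ t₂,
      HasDerivWithinAt (fun s => y s * y s) (y' τ * y τ + y τ * y' τ) (Ici τ) τ :=
    fun τ hτ => (hder τ hτ).mul (hder τ hτ)
  have hmain := le_gronwallBound_of_liminf_deriv_right_le (f := fun s => y s * y s)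
    (f' := fun τ => y' τ * y τ + y τ * y' τ) (a := t₁) (b := t₂) (δ := Z 1 n t₁ ^ 2)
    (K := 2 * (Λ * (ε⁻¹ * K ^ 10)) * β + lam) (ε := σ ^ 2 / lam)
    (hyc.mul hyc) (fun τ hτ r hr => (hf' τ hτ).liminf_right_slope_le hr) (by simp [hy, sq]) ?_
  · simpa [hy, sq] using hmain t ht
  intro τ hτ
  have hτ0 : 0 ≤ τ := ht₁.trans hτ.1
  have hg : 0 ≤ ε⁻¹ * K ^ 10 := by positivity
  -- decomposition of the velocity: y' = -Λ g b y + e, |e| ≤ σ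
  set e : ℝ := y' τ - Λ * (-(ε⁻¹ * K ^ 10 * S 1 n τ * y τ)) with he
  have hdec : y' τ = -(Λ * (ε⁻¹ * K ^ 10) * S 1 n τ * y τ) + e := by rw [he]; ring
  have he_abs : |e| ≤ σ := (hsol.eqZ2 n τ hτ0).trans (hσ τ hτ)
  have he_sq : e ^ 2 ≤ σ ^ 2 := by
    have := pow_le_pow_left₀ (abs_nonneg _) he_abs 2; rwa [sq_abs] at this
  -- damping: -2Λ g b y² ≤ 2Λ g β y²
  have hdamp : -(2 * (Λ * (ε⁻¹ * K ^ 10)) * S 1 n τ * y τ ^ 2) ≤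
      2 * (Λ * (ε⁻¹ * K ^ 10)) * β * y τ ^ 2 := by
    have hb' := hb τ hτ
    have hy2 : 0 ≤ y τ ^ 2 := sq_nonneg _
    have h1 : Λ * (ε⁻¹ * K ^ 10) * (-β) * y τ ^ 2 ≤ Λ * (ε⁻¹ * K ^ 10) * S 1 n τ * y τ ^ 2 :=
      mul_le_mul_of_nonneg_right (mul_le_mul_of_nonneg_left hb' (mul_nonneg hΛ0 hg)) hy2
    linarith
  -- forcing: 2 y e ≤ λ y² + σ²/λ
  have hforce : 2 * y τ * e ≤ lam * y τ ^ 2 + σ ^ 2 / lam :=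
    (two_mul_mul_le_of_pos hlam _ _).trans (add_le_add le_rfl (div_le_div_of_nonneg_right he_sq hlam.le))
  calc y' τ * y τ + y τ * y' τ
      = -(2 * (Λ * (ε⁻¹ * K ^ 10)) * S 1 n τ * y τ ^ 2) + 2 * y τ * e := by rw [hdec]; ring
    _ ≤ 2 * (Λ * (ε⁻¹ * K ^ 10)) * β * y τ ^ 2 + (lam * y τ ^ 2 + σ ^ 2 / lam) :=
        add_le_add hdamp hforce
    _ = (2 * (Λ * (ε⁻¹ * K ^ 10)) * β + lam) * (y τ * y τ) + σ ^ 2 / lam := by ring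

/-- **Tao's regime at the cascade level**: if the clock `b_n ≥ 0` on the window, then for every
`λ > 0`, `Z_{c,n}(t)² ≤ gronwallBound (Z_{c,n}(t₁)²) λ (σ²/λ) (t - t₁)` — no amplification by
`Λₙε⁻¹K¹⁰`. [cite: Tao2016AveragedNS, Theorem 5.3 proof p. 29] -/
theorem SplitODESystem.asym_c_sq_le_of_clock_nonneg (hsol : SplitODESystem ε₀ K ε C₁ C₂ n₀ S Z E)
    (hε₀ : -1 < ε₀) (hε : 0 < ε) {n : ℤ} {t₁ t₂ σ lam : ℝ} (ht₁ : 0 ≤ t₁) (hlam : 0 < lam)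
    (hb : ∀ t ∈ Ico t₁ t₂, 0 ≤ S 1 n t)
    (hσ : ∀ t ∈ Ico t₁ t₂, C₁ * (1 + ε₀) ^ ((2 : ℝ) * n) * Real.sqrt (E n t) ≤ σ)
    {t : ℝ} (ht : t ∈ Icc t₁ t₂) :
    Z 1 n t ^ 2 ≤ gronwallBound (Z 1 n t₁ ^ 2) lam (σ ^ 2 / lam) (t - t₁) := by
  have h := hsol.asym_c_sq_le_gronwallBound hε₀ hε (β := 0) ht₁ hlam
    (fun s hs => by simpa using hb s hs) hσ ht
  simpa using h

/-- **Channels (P)+(H) at the cascade level, rotor neutral (PROVED).** Let `(S,Z,E)` solve the split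
system; fix a shell `n` and a window `[t₁,t₂]`, `t₁ ≥ 0`, on which: the pump rate
`Λₙ(εb_n + ε²e^{-K¹⁰}S_{c,n}) ≤ M`, the hand-off rate `Λₙ(1+ε₀)^{5/2}K·S_{a,n+1} ≤ M`, the symmetric
amplitudes `|S_{a,n}|, |S_{d,n}| ≤ R`, the amplifier asymmetry `|Z_{c,n}| ≤ η_c`, and the sources of
rows (6.Z1), (6.Z3) `C₁(1+ε₀)^{2n}E_n^{1/2} ≤ σ`. Then for every `λ > 0` and `t ∈ [t₁,t₂]`,
`Z_{a,n}(t)² + Z_{d,n}(t)² ≤ gronwallBound (Z_{a,n}(t₁)² + Z_{d,n}(t₁)²) (2M + λ) (2G²/λ) (t - t₁)` with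
`G = σ + Λₙε⁻²Rη_c`: the rotor terms `∓Λₙε⁻²S_{c,n}Z_aZ_d` cancel in `∂(Z_a² + Z_d²)`, so `ε⁻²` is never
a rate — it only multiplies the (damped) `Z_c` in the slip forcing. [cite: Tao2016AveragedNS, Theorem 5.3 proof pp. 29–30] -/
theorem SplitODESystem.asym_ad_sq_le_gronwallBound (hsol : SplitODESystem ε₀ K ε C₁ C₂ n₀ S Z E)
    (hε₀ : -1 < ε₀) (hε : 0 < ε) {n : ℤ} {t₁ t₂ M R ηc σ lam : ℝ} (ht₁ : 0 ≤ t₁) (hlam : 0 < lam)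
    (hR0 : 0 ≤ R)
    (hM0 : ∀ t ∈ Ico t₁ t₂, (1 + ε₀) ^ ((5 : ℝ) * n / 2) *
      (ε * S 1 n t + ε ^ 2 * Real.exp (-K ^ 10) * S 2 n t) ≤ M)
    (hM2 : ∀ t ∈ Ico t₁ t₂, (1 + ε₀) ^ ((5 : ℝ) * n / 2) *
      ((1 + ε₀) ^ ((5 : ℝ) / 2) * K * S 0 (n + 1) t) ≤ M)
    (hRa : ∀ t ∈ Ico t₁ t₂, |S 0 n t| ≤ R) (hRd : ∀ t ∈ Ico t₁ t₂, |S 3 n t| ≤ R)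
    (hc : ∀ t ∈ Ico t₁ t₂, |Z 1 n t| ≤ ηc)
    (hσ : ∀ t ∈ Ico t₁ t₂, C₁ * (1 + ε₀) ^ ((2 : ℝ) * n) * Real.sqrt (E n t) ≤ σ)
    {t : ℝ} (ht : t ∈ Icc t₁ t₂) :
    Z 0 n t ^ 2 + Z 2 n t ^ 2 ≤
      gronwallBound (Z 0 n t₁ ^ 2 + Z 2 n t₁ ^ 2) (2 * M + lam)
        (2 * (σ + (1 + ε₀) ^ ((5 : ℝ) * n / 2) * (ε ^ 2)⁻¹ * R * ηc) ^ 2 / lam) (t - t₁) := by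
  set Λ : ℝ := (1 + ε₀) ^ ((5 : ℝ) * n / 2) with hΛ
  have hΛ0 : 0 ≤ Λ := (Real.rpow_pos_of_pos (by linarith) _).le
  set G : ℝ := σ + Λ * (ε ^ 2)⁻¹ * R * ηc with hG
  -- the two scalar coordinates and their right derivatives
  set ya : ℝ → ℝ := Z 0 n with hya
  set yd : ℝ → ℝ := Z 2 n with hyd
  set ya' : ℝ → ℝ := fun τ => derivWithin (Z 0 n) (Ici 0) τ with hya'
  set yd' : ℝ → ℝ := fun τ => derivWithin (Z 2 n) (Ici 0) τ with hyd'
  have hdera : ∀ τ ∈ Ico t₁ t₂, HasDerivWithinAt ya (ya' τ) (Ici τ) τ := fun τ hτ =>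
    hasDerivWithinAt_Ici_of_contDiffOn (hsol.contDiffOn_Z 0 n) (ht₁.trans hτ.1)
  have hderd : ∀ τ ∈ Ico t₁ t₂, HasDerivWithinAt yd (yd' τ) (Ici τ) τ := fun τ hτ =>
    hasDerivWithinAt_Ici_of_contDiffOn (hsol.contDiffOn_Z 2 n) (ht₁.trans hτ.1)
  have hyac : ContinuousOn ya (Icc t₁ t₂) :=
    (hsol.contDiffOn_Z 0 n).continuousOn.mono fun s hs => (ht₁.trans hs.1 : (0 : ℝ) ≤ s)
  have hydc : ContinuousOn yd (Icc t₁ t₂) :=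
    (hsol.contDiffOn_Z 2 n).continuousOn.mono fun s hs => (ht₁.trans hs.1 : (0 : ℝ) ≤ s)
  have hf' : ∀ τ ∈ Ico t₁ t₂, HasDerivWithinAt (fun s => ya s * ya s + yd s * yd s)
      ((ya' τ * ya τ + ya τ * ya' τ) + (yd' τ * yd τ + yd τ * yd' τ)) (Ici τ) τ := fun τ hτ =>
    ((hdera τ hτ).mul (hdera τ hτ)).add ((hderd τ hτ).mul (hderd τ hτ))
  have hmain := le_gronwallBound_of_liminf_deriv_right_le
    (f := fun s => ya s * ya s + yd s * yd s)
    (f' := fun τ => (ya' τ * ya τ + ya τ * ya' τ) + (yd' τ * yd τ + yd τ * yd' τ)) (a := t₁) (b := t₂)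
    (δ := Z 0 n t₁ ^ 2 + Z 2 n t₁ ^ 2) (K := 2 * M + lam) (ε := 2 * G ^ 2 / lam)
    ((hyac.mul hyac).add (hydc.mul hydc)) (fun τ hτ r hr => (hf' τ hτ).liminf_right_slope_le hr)
    (by simp [hya, hyd, sq]) ?_
  · simpa [hya, hyd, sq] using hmain t ht
  intro τ hτ
  have hτ0 : 0 ≤ τ := ht₁.trans hτ.1
  -- the exact decomposition of the two velocities into field + error
  set ea : ℝ := ya' τ - Λ * (ε * S 1 n τ * ya τ + ε ^ 2 * Real.exp (-K ^ 10) * S 2 n τ * ya τ -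
      (ε ^ 2)⁻¹ * S 2 n τ * yd τ + (ε ^ 2)⁻¹ * S 3 n τ * Z 1 n τ) with hea
  set ed : ℝ := yd' τ - Λ * ((ε ^ 2)⁻¹ * S 2 n τ * ya τ - (ε ^ 2)⁻¹ * S 0 n τ * Z 1 n τ +
      (1 + ε₀) ^ ((5 : ℝ) / 2) * K * S 0 (n + 1) τ * yd τ) with hed
  have hea_abs : |ea| ≤ σ := (hsol.eqZ1 n τ hτ0).trans (hσ τ hτ)
  have hed_abs : |ed| ≤ σ := (hsol.eqZ3 n τ hτ0).trans (hσ τ hτ)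
  have hda : ya' τ = ea + Λ * (ε * S 1 n τ * ya τ + ε ^ 2 * Real.exp (-K ^ 10) * S 2 n τ * ya τ -
      (ε ^ 2)⁻¹ * S 2 n τ * yd τ + (ε ^ 2)⁻¹ * S 3 n τ * Z 1 n τ) := by rw [hea]; ring
  have hdd : yd' τ = ed + Λ * ((ε ^ 2)⁻¹ * S 2 n τ * ya τ - (ε ^ 2)⁻¹ * S 0 n τ * Z 1 n τ +
      (1 + ε₀) ^ ((5 : ℝ) / 2) * K * S 0 (n + 1) τ * yd τ) := by rw [hed]; ring
  -- sizes of the slip forcing Λ ε⁻² S Z_c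
  have hr0 : 0 ≤ (ε ^ 2)⁻¹ := by positivity
  have hYc := hc τ hτ
  have hηc0 : 0 ≤ ηc := (abs_nonneg _).trans hYc
  have hslip : ∀ {s : ℝ}, |s| ≤ R → |Λ * ((ε ^ 2)⁻¹ * s * Z 1 n τ)| ≤ Λ * (ε ^ 2)⁻¹ * R * ηc := by
    intro s hs
    rw [abs_mul, abs_of_nonneg hΛ0, abs_mul, abs_mul, abs_of_nonneg hr0, mul_assoc Λ, mul_assoc Λ]
    exact mul_le_mul_of_nonneg_left (mul_le_mul (mul_le_mul_of_nonneg_left hs hr0) hYc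
      (abs_nonneg _) (mul_nonneg hr0 hR0)) hΛ0
  have hga : |ea + Λ * ((ε ^ 2)⁻¹ * S 3 n τ * Z 1 n τ)| ≤ G :=
    (abs_add_le _ _).trans (add_le_add hea_abs (hslip (hRd τ hτ)))
  have hgd : |ed - Λ * ((ε ^ 2)⁻¹ * S 0 n τ * Z 1 n τ)| ≤ G :=
    (abs_sub _ _).trans (add_le_add hed_abs (hslip (hRa τ hτ)))
  have hga2 : (ea + Λ * ((ε ^ 2)⁻¹ * S 3 n τ * Z 1 n τ)) ^ 2 ≤ G ^ 2 := by
    have := pow_le_pow_left₀ (abs_nonneg _) hga 2; rwa [sq_abs] at this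
  have hgd2 : (ed - Λ * ((ε ^ 2)⁻¹ * S 0 n τ * Z 1 n τ)) ^ 2 ≤ G ^ 2 := by
    have := pow_le_pow_left₀ (abs_nonneg _) hgd 2; rwa [sq_abs] at this
  -- rates
  have hrate_a : 2 * (Λ * (ε * S 1 n τ + ε ^ 2 * Real.exp (-K ^ 10) * S 2 n τ)) * ya τ ^ 2 ≤
      2 * M * ya τ ^ 2 := by
    have := mul_le_mul_of_nonneg_right (hM0 τ hτ) (sq_nonneg (ya τ))
    linarith
  have hrate_d : 2 * (Λ * ((1 + ε₀) ^ ((5 : ℝ) / 2) * K * S 0 (n + 1) τ)) * yd τ ^ 2 ≤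
      2 * M * yd τ ^ 2 := by
    have := mul_le_mul_of_nonneg_right (hM2 τ hτ) (sq_nonneg (yd τ))
    linarith
  -- forcing via 2yg ≤ λy² + g²/λ
  have hfa : 2 * ya τ * (ea + Λ * ((ε ^ 2)⁻¹ * S 3 n τ * Z 1 n τ)) ≤ lam * ya τ ^ 2 + G ^ 2 / lam :=
    (two_mul_mul_le_of_pos hlam _ _).trans (add_le_add le_rfl (div_le_div_of_nonneg_right hga2 hlam.le))
  have hfd : 2 * yd τ * (ed - Λ * ((ε ^ 2)⁻¹ * S 0 n τ * Z 1 n τ)) ≤ lam * yd τ ^ 2 + G ^ 2 / lam :=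
    (two_mul_mul_le_of_pos hlam _ _).trans (add_le_add le_rfl (div_le_div_of_nonneg_right hgd2 hlam.le))
  calc (ya' τ * ya τ + ya τ * ya' τ) + (yd' τ * yd τ + yd τ * yd' τ)
      = 2 * (Λ * (ε * S 1 n τ + ε ^ 2 * Real.exp (-K ^ 10) * S 2 n τ)) * ya τ ^ 2 +
          2 * (Λ * ((1 + ε₀) ^ ((5 : ℝ) / 2) * K * S 0 (n + 1) τ)) * yd τ ^ 2 +
          2 * ya τ * (ea + Λ * ((ε ^ 2)⁻¹ * S 3 n τ * Z 1 n τ)) +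
          2 * yd τ * (ed - Λ * ((ε ^ 2)⁻¹ * S 0 n τ * Z 1 n τ)) := by
        rw [hda, hdd]; ring
    _ ≤ 2 * M * ya τ ^ 2 + 2 * M * yd τ ^ 2 + (lam * ya τ ^ 2 + G ^ 2 / lam) +
          (lam * yd τ ^ 2 + G ^ 2 / lam) :=
        add_le_add (add_le_add (add_le_add hrate_a hrate_d) hfa) hfd
    _ = (2 * M + lam) * (ya τ * ya τ + yd τ * yd τ) + 2 * G ^ 2 / lam := by ring

/-- **The one-window asymmetry budget of a shell in Tao's regime, assembled (PROVED).** Under the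
hypotheses of `asym_ad_sq_le_gronwallBound` but with the amplifier asymmetry bound DERIVED from
channel (A) in Tao's regime `b_n ≥ 0` — `η_c = √(gronwallBound (Z_{c,n}(t₁)²) λ (σ²/λ) (t₂ - t₁))` —
the block obeys `Z_{a,n}² + Z_{d,n}² ≤ gronwallBound (Z_{a,n}(t₁)² + Z_{d,n}(t₁)²) (2M+λ) (2G²/λ) (t-t₁)`,
`G = σ + Λₙε⁻²Rη_c`: rates `{λ, 2M}` only, forcings `{σ, Λₙε⁻²Rη_c}`.
[cite: Tao2016AveragedNS, Theorem 5.3 proof pp. 29–30] -/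
theorem SplitODESystem.asym_ad_sq_le_of_clock_nonneg (hsol : SplitODESystem ε₀ K ε C₁ C₂ n₀ S Z E)
    (hε₀ : -1 < ε₀) (hε : 0 < ε) {n : ℤ} {t₁ t₂ M R σ lam : ℝ} (ht₁ : 0 ≤ t₁) (hlam : 0 < lam)
    (hR0 : 0 ≤ R) (hb : ∀ t ∈ Ico t₁ t₂, 0 ≤ S 1 n t)
    (hM0 : ∀ t ∈ Ico t₁ t₂, (1 + ε₀) ^ ((5 : ℝ) * n / 2) *
      (ε * S 1 n t + ε ^ 2 * Real.exp (-K ^ 10) * S 2 n t) ≤ M)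
    (hM2 : ∀ t ∈ Ico t₁ t₂, (1 + ε₀) ^ ((5 : ℝ) * n / 2) *
      ((1 + ε₀) ^ ((5 : ℝ) / 2) * K * S 0 (n + 1) t) ≤ M)
    (hRa : ∀ t ∈ Ico t₁ t₂, |S 0 n t| ≤ R) (hRd : ∀ t ∈ Ico t₁ t₂, |S 3 n t| ≤ R)
    (hσ : ∀ t ∈ Ico t₁ t₂, C₁ * (1 + ε₀) ^ ((2 : ℝ) * n) * Real.sqrt (E n t) ≤ σ)
    {t : ℝ} (ht : t ∈ Icc t₁ t₂) :
    Z 0 n t ^ 2 + Z 2 n t ^ 2 ≤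
      gronwallBound (Z 0 n t₁ ^ 2 + Z 2 n t₁ ^ 2) (2 * M + lam)
        (2 * (σ + (1 + ε₀) ^ ((5 : ℝ) * n / 2) * (ε ^ 2)⁻¹ * R *
          Real.sqrt (gronwallBound (Z 1 n t₁ ^ 2) lam (σ ^ 2 / lam) (t₂ - t₁))) ^ 2 / lam)
        (t - t₁) := by
  refine hsol.asym_ad_sq_le_gronwallBound hε₀ hε ht₁ hlam hR0 hM0 hM2 hRa hRd (fun s hs => ?_) hσ ht
  have hσ0 : 0 ≤ σ := le_trans (abs_nonneg _) ((hsol.eqZ2 n s (ht₁.trans hs.1)).trans (hσ s hs))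
  have hsq := hsol.asym_c_sq_le_of_clock_nonneg hε₀ hε ht₁ hlam hb hσ (t := s) ⟨hs.1, hs.2.le⟩
  have hmono := gronwallBound_mono (δ := Z 1 n t₁ ^ 2) (K := lam) (ε := σ ^ 2 / lam)
    (sq_nonneg _) (by positivity) hlam.le (by linarith [hs.2] : s - t₁ ≤ t₂ - t₁)
  rw [← Real.sqrt_sq_eq_abs]
  exact Real.sqrt_le_sqrt (hsq.trans hmono)

end Channels

end Literature.Analysis.FluidPDE.Tao2016AveragedNS
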